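import Literature.NumberTheory.EllipticCurves.PAdicLFunctionFunctionalEquationProofs
import HarnessLib

set_option linter.dupNamespace false
set_option autoImplicit false

/-!
# Crux `CycTangentCM.CycTangentBound` (stmt-BirchSwinnertonDyer-22628), line `tangent-cone-parity`,
# stub `stub_lowContact`: the tangent-cone inequality `λ̄_cyc ≤ m₀ + 1` below contact order three,
# from the SIGN of the functional equation alone (pure power-series algebra)

Route `CycTangentCM` (D-0145 line of ideator bsd-idea-2 on the K6 leaf `BSDpOnClassX9`; lead prover
seat `bsd-line-ctcm-p1` g0).  The registered skeleton `Cruxes/CycTangentBound/Lines/tangent_cone_parity.lean`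
composes the crux `CycTangentBound` («in every `ψ⁻¹`-twisted two-variable Katz–de Shalit frame
`G ∈ 𝒪_{ℂ_p}⟦T₁⟧⟦T₂⟧` of a maximal-CM curve at a split ordinary `p ≥ 5`, a unit coefficient of
bidegree `(i,j)` forces a unit coefficient of the inner (cyclotomic) line `G(0,T₂)` in degree
`≤ i+j+1`», i.e. `λ̄_cyc ≤ m₀ + 1`) from three stubs; this file proves the algebraic one VERBATIM:

* `stub_lowContact` — over ANY local ring `O` with `2 ∈ Oˣ` (for the crux: `O = 𝒪_{ℂ_p}`, `p` odd),
  for `G ∈ O⟦T₁⟧⟦T₂⟧` (`PowerSeries (PowerSeries O)`, outer `T₁`, inner `T₂`) carrying SIGN DATA —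
  `ε` in the residue field `k`, the inversion `ι = (1+T)⁻¹ − 1`, a `1`-unit `V`, the functional
  equation `ḡ(ι(T)) = ε·V·ḡ` of the reduced inner line `ḡ`, and its first-order companion off the
  line «`c̄₀₀ = c̄₀₁ = 0 ⟹ c̄₁₀ = ε·c̄₁₀`» — if some coefficient of `G(0,T₂)` of degree `≤ 3` is a unit
  then every unit `[T₁^i T₂^j]G` comes with a unit coefficient of `G(0,T₂)` in degree `≤ i+j+1`.

Proof (lowest-order terms): `eq_neg_one_pow_order_of_subst_eq_C_mul` — over a field, `g ≠ 0` and
`g(ι) = ε V g` force `ε = (−1)^{ord g}` (the `[T^{ord g}]`-coefficients: `[T^d]ι^d = (−1)^d`,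
`V(0) = 1`; residue-field twin of the tree's `eq_neg_one_pow_order_of_subst_inv_eq`, whose algebra
`coeff_subst_eq_sum_range` is reused); then in `stub_lowContact` the least unit degree `n₀ ≤ 3` of
the inner line either is `≤ i+j+1`, or `i+j ≤ 1`: `i = 0` contradicts minimality, and
`(i,j) = (1,0)` forces `n₀ = 3`, `ord ḡ = 3`, `ε = −1`, `c̄₁₀ = −c̄₁₀`, `c̄₁₀ = 0` (`2 ≠ 0` in `k`),
contradicting the unit at `(1,0)`.  READING: the crux can fail only at pairs with `λ(L_p(A)) ≥ 4`;
every row of a `λ`-table with `λ_p ≤ 3` is PROVABLY consistent with it.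

THEOREMS ONLY (no definition, no named fact, no `sorry`); imports no `Theses` module; nothing about
any curve, character or measure is asserted.  Supports, does not close, stmt-BirchSwinnertonDyer-22628.

References: [MazurTateTeitelbaum1986Invent] §I.17 (shape `L(ι(T)) = ε(1+T)^c L(T)` of the
functional equation); [deShalit1987] II §6.4 (the two-variable functional equation whose sign and
first-order term the stub consumes); [Cuoco1982], [Monsky1981] (directional `λ`-invariants: `m₀` is the
minimum of `λ̄` over `ℤ_p`-lines — the reading `λ̄_cyc` vs `m₀`).
-/

noncomputable section

open scoped Classical
open PowerSeries Literature.NumberTheory.EllipticCurves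

namespace Summit.BirchSwinnertonDyer.BirchSwinnertonDyer.Theorems.CycTangentCMCycTangentBoundStubLowContact

/-- **The sign of an inversion-type functional equation is `(-1)^{ord}`** (lowest-term comparison):
over a field `k`, if `g ≠ 0` and `g(ι(T)) = ε · V(T) · g(T)` with `(1 + T)(ι + 1) = 1` (i.e.
`ι = (1+T)⁻¹ - 1`) and `V(0) = 1`, then `ε = (-1)^{ord g}`.  The residue-field twin of the tree's
`eq_neg_one_pow_order_of_subst_inv_eq` (there over `ℚ_p` with `V = (1+T)^c`). [folklore] -/
theorem eq_neg_one_pow_order_of_subst_eq_C_mul {k : Type*} [Field k] {g ι V : k⟦X⟧} {ε : k}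
    (hι : (1 + X : k⟦X⟧) * (ι + 1) = 1) (hV : constantCoeff V = 1) (hg : g ≠ 0)
    (h : PowerSeries.subst ι g = C ε * V * g) :
    ε = (-1 : k) ^ g.order.toNat := by
  have hι0 : constantCoeff ι = 0 := constantCoeff_eq_zero_of_one_add_X_mul hι
  -- the linear coefficient of `ι` is `-1`
  have hι1 : coeff 1 ι = -1 := by
    have h1 := congr_arg (coeff 1) hι
    rw [add_mul, one_mul, map_add, map_add, coeff_succ_X_mul, map_add] at h1
    simp only [coeff_one, coeff_zero_eq_constantCoeff_apply, hι0, one_ne_zero, if_false, if_true,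
      zero_add, add_zero] at h1
    linear_combination h1
  -- `ι = X · q` with `q(0) = -1`
  set q : k⟦X⟧ := PowerSeries.mk fun n ↦ coeff (n + 1) ι with hq
  have hιq : ι = X * q := by
    have e := eq_X_mul_shift_add_const ι
    rwa [hι0, map_zero, add_zero] at e
  have hcq : constantCoeff q = -1 := by
    rw [hq]
    show coeff (0 + 1) ι = -1
    simpa using hι1
  -- the diagonal coefficient `[T^d] ι^d = (-1)^d`
  have hdiag : ∀ d : ℕ, coeff d (ι ^ d) = (-1) ^ d := by
    intro d
    rw [hιq, mul_pow, coeff_X_pow_mul', if_pos le_rfl, Nat.sub_self,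
      coeff_zero_eq_constantCoeff_apply, map_pow, hcq]
  -- order bookkeeping
  have hoT : g.order ≠ ⊤ := fun h' ↦ hg (order_eq_top.mp h')
  obtain ⟨m, hm⟩ := ENat.ne_top_iff_exists.mp hoT
  have hcm : coeff m g ≠ 0 := by
    have e := coeff_order hg
    rwa [← hm, ENat.toNat_coe] at e
  have hlt : ∀ d < m, coeff d g = 0 := fun d hd ↦
    coeff_of_lt_order d (by rw [← hm]; exact ENat.coe_lt_coe.mpr hd)
  rw [← hm, ENat.toNat_coe]
  -- compare the coefficients of `T^m`
  have key := congr_arg (coeff m) h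
  rw [coeff_subst_eq_sum_range hι0 g m, Finset.sum_range_succ, Finset.sum_eq_zero, zero_add, hdiag,
    mul_assoc, coeff_C_mul, coeff_mul, Finset.sum_eq_single (0, m)] at key
  · rw [coeff_zero_eq_constantCoeff_apply, hV, one_mul] at key
    exact (mul_right_cancel₀ hcm key).symm
  · rintro ⟨a, b⟩ hab hne
    have hab' : a + b = m := Finset.HasAntidiagonal.mem_antidiagonal.mp hab
    have hb : b < m := by
      rcases Nat.lt_or_ge b m with hb | hb
      · exact hb
      · exfalso
        have ha : a = 0 := by omega
        have hb' : b = m := by omega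
        exact hne (by rw [ha, hb'])
    rw [hlt b hb, mul_zero]
  · intro h0
    exact absurd (Finset.HasAntidiagonal.mem_antidiagonal.mpr (zero_add m)) h0
  · intro d hd
    rw [hlt d (Finset.mem_range.mp hd), mul_zero]

/-- In the residue field of a local ring in which `2` is a unit, `2 ≠ 0`. [folklore] -/
theorem residue_two_ne_zero {O : Type*} [CommRing O] [IsLocalRing O] (h2 : IsUnit (2 : O)) :
    (2 : IsLocalRing.ResidueField O) ≠ 0 := by
  have h := (IsLocalRing.residue_ne_zero_iff_isUnit (2 : O)).mpr h2
  rwa [map_ofNat] at h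

/-- The coefficient `[T₁^i T₂^j]` of `G ∈ O⟦T₁⟧⟦T₂⟧` (outer `T₁`, inner `T₂`) is a unit iff its
residue is non-zero; recorded in the form used below. [folklore] -/
theorem residue_coeff_eq_zero_iff_not_isUnit {O : Type*} [CommRing O] [IsLocalRing O] (x : O) :
    IsLocalRing.residue O x = 0 ↔ ¬ IsUnit x := by
  rw [← IsLocalRing.residue_ne_zero_iff_isUnit, not_not]

/-- **stub `stub_lowContact` of line `tangent-cone-parity` on crux `CycTangentBound`
(stmt-BirchSwinnertonDyer-22628) — the tangent-cone inequality below contact order three, from the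
SIGN data alone (pure algebra).**  Let `O` be a local ring with `2 ∈ Oˣ`, `k` its residue field,
`G ∈ O⟦T₁⟧⟦T₂⟧` (`PowerSeries (PowerSeries O)`, OUTER variable `T₁`, inner `T₂`; the inner line
`T₁ = 0` is `PowerSeries.constantCoeff G = G(0,T₂)`), and write `ḡ ∈ k⟦T₂⟧` for the reduction of
`G(0, T₂)` and `c̄ᵢⱼ` for the residue of `[T₁^i T₂^j]G`.  SIGN DATA: `ε ∈ k`, an inversion
`ι = (1+T)⁻¹ - 1` (`(1+T)(ι+1) = 1`) and a `1`-unit `V` (`V(0) = 1`) with the one-variable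
functional equation of the inner line `ḡ(ι(T)) = ε·V·ḡ` AND its first-order companion off the line
"`c̄₀₀ = c̄₀₁ = 0 ⟹ c̄₁₀ = ε c̄₁₀`" (the `T₁`-linear coefficient is an `ε`-eigenvector of the
tangent-plane involution once the line vanishes to order `≥ 2`).  CONCLUSION: if SOME coefficient of
`G(0,T₂)` of degree `≤ 3` is a unit (`λ̄_cyc ≤ 3`), then for every unit coefficient `[T₁^i T₂^j]G`
there is a unit coefficient of `G(0,T₂)` in degree `≤ i + j + 1` — the conclusion of
`CycTangentCM.CycTangentBound` for this `G`.  PROOF: let `n₀ ≤ 3` be the least degree of a unit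
coefficient of `G(0,T₂)`; if `n₀ ≤ i+j+1` done; else `i + j ≤ 1` and `n₀ ≥ 2`; `i = 0` contradicts
minimality; `(i,j) = (1,0)` forces `n₀ = 3`, so `ord ḡ = 3` and the lowest-term comparison
(`eq_neg_one_pow_order_of_subst_eq_C_mul`) gives `ε = (-1)^3 = -1`, whence `c̄₁₀ = -c̄₁₀`, `c̄₁₀ = 0`
(`2 ≠ 0` in `k`), contradicting the unit at `(1,0)`.  So the crux `λ̄_cyc ≤ m₀ + 1` can fail only at
pairs with `λ̄_cyc ≥ 4`.  Nothing about any curve or measure is asserted. [folklore] -/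
theorem stub_lowContact {O : Type*} [CommRing O] [IsLocalRing O] (h2 : IsUnit (2 : O))
    (G : PowerSeries (PowerSeries O))
    {ε : IsLocalRing.ResidueField O} {ι V : PowerSeries (IsLocalRing.ResidueField O)}
    (hι : (1 + PowerSeries.X) * (ι + 1) = 1) (hV : PowerSeries.constantCoeff V = 1)
    (hFE : PowerSeries.subst ι
        (PowerSeries.map (IsLocalRing.residue O) (PowerSeries.constantCoeff G)) =
      PowerSeries.C ε * V * PowerSeries.map (IsLocalRing.residue O) (PowerSeries.constantCoeff G))
    (h10 : IsLocalRing.residue O (PowerSeries.coeff 0 (PowerSeries.coeff 0 G)) = 0 →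
      IsLocalRing.residue O (PowerSeries.coeff 1 (PowerSeries.coeff 0 G)) = 0 →
      IsLocalRing.residue O (PowerSeries.coeff 0 (PowerSeries.coeff 1 G)) =
        ε * IsLocalRing.residue O (PowerSeries.coeff 0 (PowerSeries.coeff 1 G)))
    (hlow : ∃ n ≤ 3, IsUnit (PowerSeries.coeff n (PowerSeries.constantCoeff G)))
    {i j : ℕ} (hij : IsUnit (PowerSeries.coeff j (PowerSeries.coeff i G))) :
    ∃ n ≤ i + j + 1, IsUnit (PowerSeries.coeff n (PowerSeries.constantCoeff G)) := by
  classical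
  -- the least degree `n₀ ≤ 3` of a unit coefficient of the inner line
  have hex : ∃ n, IsUnit (coeff n (constantCoeff G)) := by
    obtain ⟨n, -, hn⟩ := hlow
    exact ⟨n, hn⟩
  set n₀ := Nat.find hex with hn₀def
  have hn₀u : IsUnit (coeff n₀ (constantCoeff G)) := Nat.find_spec hex
  have hmin : ∀ m < n₀, ¬ IsUnit (coeff m (constantCoeff G)) := fun m hm ↦ Nat.find_min hex hm
  have hn₀3 : n₀ ≤ 3 := by
    obtain ⟨n, hn3, hn⟩ := hlow
    exact (Nat.find_le hn).trans hn3
  by_cases hle : n₀ ≤ i + j + 1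
  · exact ⟨n₀, hle, hn₀u⟩
  exfalso
  rcases i with _ | i
  · -- `i = 0`: the unit sits on the inner line itself, below `n₀`
    rw [coeff_zero_eq_constantCoeff_apply] at hij
    exact hmin j (by omega) hij
  · -- `i = i+1`: then `i = 0`, `j = 0`, `n₀ = 3`
    have hi : i = 0 := by omega
    have hj : j = 0 := by omega
    subst hi hj
    have hn₀ : n₀ = 3 := by omega
    -- the reduction `ḡ` of the inner line has order exactly `3`
    set g : PowerSeries (IsLocalRing.ResidueField O) :=
      PowerSeries.map (IsLocalRing.residue O) (constantCoeff G) with hgdef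
    have hcoef : ∀ m, coeff m g = IsLocalRing.residue O (coeff m (constantCoeff G)) := fun m ↦ by
      rw [hgdef, coeff_map]
    have hg3 : coeff 3 g ≠ 0 := by
      rw [hcoef, ne_eq, residue_coeff_eq_zero_iff_not_isUnit, not_not, ← hn₀]
      exact hn₀u
    have hglt : ∀ m < 3, coeff m g = 0 := fun m hm ↦ by
      rw [hcoef, residue_coeff_eq_zero_iff_not_isUnit]
      exact hmin m (by omega)
    have hgne : g ≠ 0 := fun h0 ↦ hg3 (by rw [h0, map_zero])
    have hord : g.order = (3 : ℕ) := order_eq_nat.mpr ⟨hg3, hglt⟩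
    have hε : ε = -1 := by
      have e := eq_neg_one_pow_order_of_subst_eq_C_mul hι hV hgne hFE
      rw [hord, ENat.toNat_coe] at e
      rw [e]
      norm_num
    -- first-order companion: `c̄₁₀ = ε c̄₁₀ = -c̄₁₀`, so `c̄₁₀ = 0`
    have h00 : IsLocalRing.residue O (coeff 0 (coeff 0 G)) = 0 := by
      rw [coeff_zero_eq_constantCoeff_apply G, ← hcoef]
      exact hglt 0 (by omega)
    have h01 : IsLocalRing.residue O (coeff 1 (coeff 0 G)) = 0 := by
      rw [coeff_zero_eq_constantCoeff_apply G, ← hcoef]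
      exact hglt 1 (by omega)
    have h := h10 h00 h01
    rw [hε] at h
    have hzero : IsLocalRing.residue O (coeff 0 (coeff 1 G)) = 0 := by
      have h2k := residue_two_ne_zero h2
      have : (2 : IsLocalRing.ResidueField O) * IsLocalRing.residue O (coeff 0 (coeff 1 G)) = 0 := by
        linear_combination h
      rcases mul_eq_zero.mp this with h' | h'
      · exact absurd h' h2k
      · exact h'
    rw [residue_coeff_eq_zero_iff_not_isUnit] at hzero
    exact hzero hij

end Summit.BirchSwinnertonDyer.BirchSwinnertonDyer.Theorems.CycTangentCMCycTangentBoundStubLowContact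

end
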